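import Summits.CriticalPhenomena.PercolationContinuityZ3.Theorems.PercNearOneGluingNoHeavyLowerTailLossyPocketCoverCore
import HarnessLib

/-!
# `NoHeavyLowerTail` (stmt-CriticalPhenomena-4575) — lossy pocket cover, LIST form and the bounded-list corollary

Support file (engine seat `prim-cplus-engine` g2; `--supports stmt-CriticalPhenomena-4575`).  No definitions, no
named facts, no sorries.  `LossyPocket.lowerTail_le_list_add`: the witness of `LossyPocket.lowerTail_le_add_of_inside` may be chosen
per pocket state from a finite list `L ⊆ A`; `LossyPocket.lowerTail_le_card_mul`: with zero slack (each pocket state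
covered by a port or by a relay of `L` at least as fragile inside `Wᶜ` as some port) `μ{1 ≤ N ≤ j} ≤ |L|·M` — a
k-uniform cumulative-isolation class containing Kozma–Nitzan's Theorem 8 (`|L| = 1`) and every observer with a bounded
free component (`|L| ≤ 2^{|Z|−1}` pocket champions).  ENGINE-g2.md §4–§5.
-/

noncomputable section

namespace Summit.CriticalPhenomena.PercolationContinuityZ3.Theorems

open MeasureTheory Set Literature.Probability.LatticeModels Literature.Probability.Percolation
open scoped Classical BigOperators

namespace LossyPocket

variable {n : ℕ}

/-- **The lossy LIST cover**: the witness may be chosen per pocket state from a finite list `L ⊆ A`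
(`c(W,R) ∈ L`, with the slack hypothesis for `c(W,R)`); then
`μ{1 ≤ N ≤ j} ≤ Σ_{c ∈ L} μ({o ↔ A} ∩ {|π(c)| ≤ j}) + Σ_W Σ_R Δ(W,R) · μ{W(ω) = W, N(ω) = R}`.
With `Δ ≡ 0` and `c(W,R)` a champion of `G[Wᶜ]` this is the STRICT cover `bad ≤ Σ_{c ∈ L} Φ_G(c)` for any list `L`
containing a champion of `G[Wᶜ]` for every realised pocket `W` — e.g. CIL with constant `#L` for observers whose
free component admits `#L` pocket champions (one-layer observers: `#L = 1`, Kozma–Nitzan's Theorem 8). [this work] -/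
theorem lowerTail_le_list_add (w : Sym2 (Fin n) → unitInterval) (A : Finset (Fin n)) (o : Fin n) (j : ℕ)
    (hoA : o ∉ A) (L : Finset (Fin n)) (hLA : L ⊆ A) (c : Finset (Fin n) → Finset (Fin n) → Fin n)
    (hcL : ∀ W N, c W N ∈ L) (Δ : Finset (Fin n) → Finset (Fin n) → ℝ) (hΔ0 : ∀ W N, 0 ≤ Δ W N)
    (hΔ : ∀ W N : Finset (Fin n),
      ({ω : BondConfig (Fin n) |
          (Finset.univ.filter fun v => ω ∈ openConnIn ((↑A : Set (Fin n))ᶜ) o v) = W ∧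
          (A.filter fun a => ω ∈ openConnIn (insert a ((↑A : Set (Fin n))ᶜ)) o a) = N} : Set _).Nonempty →
      N.Nonempty → c W N ∉ N →
        (prodBernoulli w).real {ω : BondConfig (Fin n) |
            (A.filter fun y => ∃ a ∈ N, ω ∈ openConnIn ((↑W : Set (Fin n))ᶜ) a y).card ≤ j} ≤
          (prodBernoulli w).real {ω : BondConfig (Fin n) |
            ((∃ a ∈ N, ω ∈ openConnIn ((↑W : Set (Fin n))ᶜ) (c W N) a) ∧
                (A.filter fun y => ∃ a ∈ N, ω ∈ openConnIn ((↑W : Set (Fin n))ᶜ) a y).card ≤ j) ∨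
              ((¬ ∃ a ∈ N, ω ∈ openConnIn ((↑W : Set (Fin n))ᶜ) (c W N) a) ∧
                (A.filter fun y => ω ∈ openConnIn ((↑W : Set (Fin n))ᶜ) (c W N) y).card ≤ j)} + Δ W N) :
    (prodBernoulli w).real {ω : BondConfig (Fin n) |
        1 ≤ (A.filter fun x => ω ∈ openConn o x).card ∧ (A.filter fun x => ω ∈ openConn o x).card ≤ j} ≤
      (∑ c' ∈ L, (prodBernoulli w).real ((⋃ a' ∈ A, (openConn o a' : Set (BondConfig (Fin n)))) ∩
          {ω : BondConfig (Fin n) | (A.filter fun x => ω ∈ openConn c' x).card ≤ j})) +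
        ∑ W : Finset (Fin n), ∑ N : Finset (Fin n), Δ W N *
          (prodBernoulli w).real {ω : BondConfig (Fin n) |
            (Finset.univ.filter fun v => ω ∈ openConnIn ((↑A : Set (Fin n))ᶜ) o v) = W ∧
            (A.filter fun a => ω ∈ openConnIn (insert a ((↑A : Set (Fin n))ᶜ)) o a) = N} := by
  set μ := prodBernoulli w with hμ
  set bad : Set (BondConfig (Fin n)) := {ω | 1 ≤ (A.filter fun x => ω ∈ openConn o x).card ∧
    (A.filter fun x => ω ∈ openConn o x).card ≤ j} with hbad
  set U : Set (BondConfig (Fin n)) := ⋃ a' ∈ A, (openConn o a' : Set (BondConfig (Fin n))) with hU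
  set S : Fin n → Set (BondConfig (Fin n)) := fun c' =>
    {ω | (A.filter fun x => ω ∈ openConn c' x).card ≤ j} with hS
  set PK : Finset (Fin n) → Finset (Fin n) → Set (BondConfig (Fin n)) := fun W N =>
    {ω | (Finset.univ.filter fun v => ω ∈ openConnIn ((↑A : Set (Fin n))ᶜ) o v) = W ∧
      (A.filter fun a => ω ∈ openConnIn (insert a ((↑A : Set (Fin n))ᶜ)) o a) = N} with hPK
  have key : ∀ W N : Finset (Fin n),
      μ.real (PK W N ∩ bad) ≤ μ.real (PK W N ∩ (U ∩ S (c W N))) + Δ W N * μ.real (PK W N) :=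
    fun W N => term_le_add_of_inside w A o (c W N) j hoA (hLA (hcL W N)) W N (hΔ0 W N) (hΔ W N)
  -- the witness term is one of the list's terms
  have hlist : ∀ W N : Finset (Fin n),
      μ.real (PK W N ∩ (U ∩ S (c W N))) ≤ ∑ c' ∈ L, μ.real (PK W N ∩ (U ∩ S c')) :=
    fun W N => Finset.single_le_sum (f := fun c' => μ.real (PK W N ∩ (U ∩ S c')))
      (fun c' _ => measureReal_nonneg) (hcL W N)
  have hsum : ∀ c' : Fin n, μ.real (U ∩ S c') = ∑ W : Finset (Fin n), ∑ N : Finset (Fin n),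
      μ.real (PK W N ∩ (U ∩ S c')) := fun c' => pocketReduction_sum_pocketEvent w A o (U ∩ S c')
  rw [pocketReduction_sum_pocketEvent w A o bad]
  calc ∑ W : Finset (Fin n), ∑ N : Finset (Fin n), μ.real (PK W N ∩ bad)
      ≤ ∑ W : Finset (Fin n), ∑ N : Finset (Fin n),
          ((∑ c' ∈ L, μ.real (PK W N ∩ (U ∩ S c'))) + Δ W N * μ.real (PK W N)) :=
        Finset.sum_le_sum fun W _ => Finset.sum_le_sum fun N _ => (key W N).trans (by linarith [hlist W N])
    _ = (∑ W : Finset (Fin n), ∑ N : Finset (Fin n), ∑ c' ∈ L, μ.real (PK W N ∩ (U ∩ S c'))) +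
          ∑ W : Finset (Fin n), ∑ N : Finset (Fin n), Δ W N * μ.real (PK W N) := by
        simp only [Finset.sum_add_distrib]
    _ = (∑ c' ∈ L, μ.real (U ∩ S c')) +
          ∑ W : Finset (Fin n), ∑ N : Finset (Fin n), Δ W N * μ.real (PK W N) := by
        congr 1
        calc ∑ W : Finset (Fin n), ∑ N : Finset (Fin n), ∑ c' ∈ L, μ.real (PK W N ∩ (U ∩ S c'))
            = ∑ W : Finset (Fin n), ∑ c' ∈ L, ∑ N : Finset (Fin n), μ.real (PK W N ∩ (U ∩ S c')) :=
              Finset.sum_congr rfl fun W _ => Finset.sum_comm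
          _ = ∑ c' ∈ L, ∑ W : Finset (Fin n), ∑ N : Finset (Fin n), μ.real (PK W N ∩ (U ∩ S c')) :=
              Finset.sum_comm
          _ = ∑ c' ∈ L, μ.real (U ∩ S c') := Finset.sum_congr rfl fun c' _ => (hsum c').symm

/-- **Corollary: a new k-uniform class (exact cover by a short list).**  If a list `L ⊆ A` contains, for every
realised pocket data `(W, R)` with `R ≠ ∅`, a relay `c(W,R) ∈ L` that is either a port (`c(W,R) ∈ R`) or at least as
`j`-fragile inside `Wᶜ` as some port, and every relay of `L` satisfies `μ{|π(c)| ≤ j} ≤ M`, then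
`μ{1 ≤ N ≤ j} ≤ |L| · M` — e.g. `M = (|A|−1)t/(|A|−j)` by Markov.  With `L = {champion of G[Wᶜ] : W a possible pocket}`
this is the cumulative isolation lemma with constant `#L ≤ 2^{|Z|−1}` for observers whose free support-component `Z` is
bounded (`|Z| = 1`: Kozma–Nitzan's Theorem 8, constant 1). [this work] -/
theorem lowerTail_le_card_mul (w : Sym2 (Fin n) → unitInterval) (A : Finset (Fin n)) (o : Fin n) (j : ℕ)
    (hoA : o ∉ A) (L : Finset (Fin n)) (hLA : L ⊆ A) (c : Finset (Fin n) → Finset (Fin n) → Fin n)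
    (hcL : ∀ W N, c W N ∈ L)
    (hc : ∀ W N : Finset (Fin n),
      ({ω : BondConfig (Fin n) |
          (Finset.univ.filter fun v => ω ∈ openConnIn ((↑A : Set (Fin n))ᶜ) o v) = W ∧
          (A.filter fun a => ω ∈ openConnIn (insert a ((↑A : Set (Fin n))ᶜ)) o a) = N} : Set _).Nonempty →
      N.Nonempty → c W N ∉ N →
        (prodBernoulli w).real {ω : BondConfig (Fin n) |
            (A.filter fun y => ∃ a ∈ N, ω ∈ openConnIn ((↑W : Set (Fin n))ᶜ) a y).card ≤ j} ≤
          (prodBernoulli w).real {ω : BondConfig (Fin n) |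
            ((∃ a ∈ N, ω ∈ openConnIn ((↑W : Set (Fin n))ᶜ) (c W N) a) ∧
                (A.filter fun y => ∃ a ∈ N, ω ∈ openConnIn ((↑W : Set (Fin n))ᶜ) a y).card ≤ j) ∨
              ((¬ ∃ a ∈ N, ω ∈ openConnIn ((↑W : Set (Fin n))ᶜ) (c W N) a) ∧
                (A.filter fun y => ω ∈ openConnIn ((↑W : Set (Fin n))ᶜ) (c W N) y).card ≤ j)})
    (M : ℝ) (hM : ∀ c' ∈ L, (prodBernoulli w).real {ω : BondConfig (Fin n) |
      (A.filter fun x => ω ∈ openConn c' x).card ≤ j} ≤ M) :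
    (prodBernoulli w).real {ω : BondConfig (Fin n) |
        1 ≤ (A.filter fun x => ω ∈ openConn o x).card ∧ (A.filter fun x => ω ∈ openConn o x).card ≤ j} ≤
      L.card * M := by
  have key := lowerTail_le_list_add w A o j hoA L hLA c hcL (fun _ _ => 0) (fun _ _ => le_rfl)
    (fun W N hP hN hcN => by linarith [hc W N hP hN hcN])
  simp only [zero_mul, Finset.sum_const_zero, add_zero] at key
  refine key.trans ?_
  calc (∑ c' ∈ L, (prodBernoulli w).real ((⋃ a' ∈ A, (openConn o a' : Set (BondConfig (Fin n)))) ∩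
          {ω : BondConfig (Fin n) | (A.filter fun x => ω ∈ openConn c' x).card ≤ j}))
      ≤ ∑ c' ∈ L, M := Finset.sum_le_sum fun c' hc' =>
          (measureReal_mono inter_subset_right).trans (hM c' hc')
    _ = L.card * M := by rw [Finset.sum_const, nsmul_eq_mul]

end LossyPocket

end Summit.CriticalPhenomena.PercolationContinuityZ3.Theorems

end
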